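import Mathlib
import Summits.AtomisticToContinuum.Crystallization.Theses.ExcessDecayLiouville

/-!
# Sketch — crux `PhononStability` (stmt-AtomisticToContinuum-9333), ideator 2, round 1

First checkable statements of the three crux ideas filed from this seat (no proofs; `sorry` only):

* card C `finite-range-label-transfer` : `phononStability_of_labelStability`,
  `labelStability_of_finiteRange`, `tailBound_hcp` (label pull-back; tail absorbed by a discrete
  Poincaré inequality on the hcp contact graph);
* card A `monomial-affine-vertex-window` : `hess_monomial_affine`, `arc_in_triangle`,
  `vertex_principle`, `hlab_scaling` (the LJ bond Hessian is affine in the monomials `r⁻¹⁴, r⁻⁸`;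
  window-uniformity becomes a vertex principle; dilations are exact);
* card B `fourier-free-sos-certificate` : `sosForm_nonneg`, `stability_of_certificate`
  (a Gram / sum-of-squares certificate of finite differences in label space certifies the
  finite-range inequality at every window point dominating its rational minorant coefficients).

The `let`-abbreviations of the route (`Adm`, `Inner`, `Hess`) are copied verbatim as `def`s.
-/

noncomputable section

namespace Summit.AtomisticToContinuum.Crystallization.Cruxes.PhononStability.SketchIdeator2

open scoped BigOperators Classical
open Literature.MathematicalPhysics.StatisticalMechanics

/-- ambient space -/
abbrev E3 := EuclideanSpace ℝ (Fin 3)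

/-- admissible cell (route `Adm`). -/
def Adm (A : E3 →L[ℝ] E3) : Prop :=
  ∃ R : E3 ≃ₗᵢ[ℝ] E3, ‖A - (97 / 100 : ℝ) • (R.toContinuousLinearEquiv : E3 →L[ℝ] E3)‖ ≤ 1 / 40

/-- hcp-like inner displacement (route `Inner`). -/
def Inner (t : Fin 2 → E3) (A : E3 →L[ℝ] E3) : Prop :=
  ‖t 1 - t 0 - A (barlowOffset 1 + layerNormal (Real.sqrt (2 / 3)))‖ ≤ 1 / 40

/-- LJ bond Hessian quadratic form (route `Hess`). -/
def Hess (e w : E3) : ℝ :=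
  deriv (deriv lennardJones) ‖e‖ * (inner ℝ e w / ‖e‖) ^ 2 +
    deriv lennardJones ‖e‖ / ‖e‖ * (‖w‖ ^ 2 - (inner ℝ e w / ‖e‖) ^ 2)

/-! ## Labels (card C): sublattice index × integer coordinates in the hcp period lattice -/

/-- a site label: sublattice `m : Fin 2` and lattice coordinates `z : Fin 3 → ℤ`. -/
abbrev Label := Fin 2 × (Fin 3 → ℤ)

/-- the period-lattice vector with integer coordinates `z` (route `Λ`). -/
def latVec (z : Fin 3 → ℤ) : E3 :=
  (z 0 : ℝ) • triangularVec₁ 1 + (z 1 : ℝ) • triangularVec₂ 1 +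
    (z 2 : ℝ) • layerNormal (2 * Real.sqrt (2 / 3))

/-- actual position of label `a` in the two-lattice with data `(t, A)`; its range is the route's
`Sites t A`, bijectively for admissible data. -/
def sitePos (t : Fin 2 → E3) (A : E3 →L[ℝ] E3) (a : Label) : E3 :=
  t a.1 + A (latVec a.2)

/-- label-space Hessian form, restricted to pairs whose ACTUAL distance satisfies `P`
(`P = ⊤`: full form; `(· ≤ rc)`: near field; `(rc < ·)`: far field). -/
def Hlab (P : ℝ → Prop) (t : Fin 2 → E3) (A : E3 →L[ℝ] E3) (w : Label → E3) : ℝ :=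
  (∑' a : Label, ∑' b : Label,
      if a ≠ b ∧ P (dist (sitePos t A a) (sitePos t A b)) then
        Hess (sitePos t A a - sitePos t A b) (w a - w b) else 0) / 2

/-- label-space nearest-neighbour strain form (the typed left-hand side). -/
def Glab (t : Fin 2 → E3) (A : E3 →L[ℝ] E3) (w : Label → E3) : ℝ :=
  ∑' a : Label, ∑' b : Label,
    if dist (sitePos t A a) (sitePos t A b) ≤ 11 / 10 then ‖w a - w b‖ ^ 2 else 0

/-- the crux, pulled back to labels. -/
def LabelStability : Prop :=
  ∃ κ : ℝ, 0 < κ ∧ ∀ (t : Fin 2 → E3) (A : E3 →L[ℝ] E3), Adm A → Inner t A →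
    ∀ w : Label → E3, (Function.support w).Finite →
      κ * Glab t A w ≤ Hlab (fun _ => True) t A w

/-- **C1 (label pull-back).** `sitePos t A` is a bijection `Label → Sites t A` for admissible
`(t, A)` (`A` invertible, the inner shift is off-lattice), so the typed `tsum`s over the subtype
`Sites t A` re-index to labels. -/
theorem phononStability_of_labelStability :
    LabelStability → Theses.ExcessDecayLiouville.PhononStability := by
  sorry

/-- finite-range stability with constant `κ` at actual cut-off `rc`. -/
def FiniteRangeStability (rc κ : ℝ) : Prop :=
  ∀ (t : Fin 2 → E3) (A : E3 →L[ℝ] E3), Adm A → Inner t A →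
    ∀ w : Label → E3, (Function.support w).Finite →
      κ * Glab t A w ≤ Hlab (· ≤ rc) t A w

/-- tail bound: the far field beyond `rc` is `ε`-small relative to the NN strain form. -/
def TailBound (rc ε : ℝ) : Prop :=
  ∀ (t : Fin 2 → E3) (A : E3 →L[ℝ] E3), Adm A → Inner t A →
    ∀ w : Label → E3, (Function.support w).Finite →
      |Hlab (rc < ·) t A w| ≤ ε * Glab t A w

/-- **C2 (finite-range transfer).** `Hlab ⊤ = Hlab (· ≤ rc) + Hlab (rc < ·)` termwise, so a
finite-range constant `κ` and a tail constant `ε < κ` give the crux with `κ - ε`. -/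
theorem labelStability_of_finiteRange {rc κ ε : ℝ} (hε : ε < κ)
    (h₁ : FiniteRangeStability rc κ) (h₂ : TailBound rc ε) : LabelStability := by
  sorry

/-- **C3 (discrete Poincaré / path lemma on the hcp contact graph, with the r⁻⁸ decay of the LJ
force constants).** For `|z| > 1.109`, `‖K(z)‖ = 7|z|⁻⁸ − 13|z|⁻¹⁴ ≤ 7|z|⁻⁸`, and
`∑_p ‖w(p+z) − w(p)‖² ≤ w(z)·G(w)` with `w(z) ≤ 0.4|z|² + O(|z|)` by spreading the telescoping
sum over zig-zag nearest-neighbour paths; summing the shells beyond `rc` gives `≈ 9/rc³`.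
The constant `10` is the sketch value to be certified (rc = 4 ⇒ 0.16, rc = 5 ⇒ 0.08 < 0.277). -/
theorem tailBound_hcp (rc : ℝ) (hrc : 3 ≤ rc) : TailBound rc (10 / rc ^ 3) := by
  sorry

/-! ## Card A: affinity in the monomials, triangle enclosure, vertex principle, dilation exactness -/

/-- **A1.** On `e ≠ 0` the LJ bond Hessian is AFFINE in `(X, Y) = (‖e‖⁻¹⁴, ‖e‖⁻⁸)`:
`Hess e w = (14 X − 8 Y)(ê·w)² + (Y − X)‖w‖²` (from `V' = −r⁻¹³ + r⁻⁷`, `V'' = 13r⁻¹⁴ − 7r⁻⁸`). -/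
theorem hess_monomial_affine (e w : E3) (he : e ≠ 0) :
    Hess e w = (14 * (‖e‖ ^ 14)⁻¹ - 8 * (‖e‖ ^ 8)⁻¹) * (inner ℝ e w / ‖e‖) ^ 2
      + ((‖e‖ ^ 8)⁻¹ - (‖e‖ ^ 14)⁻¹) * ‖w‖ ^ 2 := by
  sorry

/-- **A1' (cell pull-back).** With `e = A d` (intra-sublattice bonds are EXACTLY `A d`, `d` a fixed
reference vector; inter bonds are `A (d + σ)` with ONE shared `σ = A⁻¹ s`, `|σ| ≤ 0.0265`), the bond
Hessian in the pulled-back displacement `Aᵀ w` has the FIXED reference direction `d`; the cell enters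
only through the scalars `14 r⁻¹⁶ − 8 r⁻¹⁰`, `r⁻⁸ − r⁻¹⁴` of `r = ‖A d‖` (and through `‖w‖²`, i.e. the
metric `(AᵀA)⁻¹` on the pulled-back side, a single matrix shared by all bonds). -/
theorem hess_pullback (A : E3 →L[ℝ] E3) (d w : E3) (h : A d ≠ 0) :
    Hess (A d) w = (14 * (‖A d‖ ^ 16)⁻¹ - 8 * (‖A d‖ ^ 10)⁻¹) *
        (inner ℝ d (ContinuousLinearMap.adjoint A w)) ^ 2
      + ((‖A d‖ ^ 8)⁻¹ - (‖A d‖ ^ 14)⁻¹) * ‖w‖ ^ 2 := by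
  sorry

/-- **A2 (arc in triangle).** The monomial arc `r ↦ (r⁻¹⁴, r⁻⁸)` over `[r₁, r₂]` is the graph of the
concave function `Y = X^{4/7}`; it lies in the triangle spanned by its two endpoints and the
intersection `T` of the endpoint tangents (slopes `(4/7) rᵢ⁶`). -/
theorem arc_in_triangle (r₁ r₂ : ℝ) (h₁ : 0 < r₁) (h₁₂ : r₁ < r₂) :
    ∃ T : ℝ × ℝ, ∀ r ∈ Set.Icc r₁ r₂,
      (((r ^ 14)⁻¹, (r ^ 8)⁻¹) : ℝ × ℝ) ∈
        convexHull ℝ ({((r₁ ^ 14)⁻¹, (r₁ ^ 8)⁻¹), ((r₂ ^ 14)⁻¹, (r₂ ^ 8)⁻¹), T} : Set (ℝ × ℝ)) := by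
  sorry

/-- **A3 (vertex principle = concavity of the stability constant in affinely entering
coefficients).** If the form at parameter `p` is the `θ`-barycentre of the vertex forms and every
vertex form dominates `κ • G`, so does the form at `p`. (Trivial; it is what turns window-uniformity
into finitely many constant-coefficient problems once A1/A2 make the dependence affine.) -/
theorem vertex_principle {ι P W : Type*} [Fintype ι] (H : P → W → ℝ) (G : W → ℝ)
    (vert : ι → P) (κ : ℝ) (hv : ∀ i w, κ * G w ≤ H (vert i) w)
    (p : P) (θ : ι → ℝ) (hθ : ∀ i, 0 ≤ θ i) (hθ₁ : ∑ i, θ i = 1)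
    (haff : ∀ w, H p w = ∑ i, θ i * H (vert i) w) :
    ∀ w, κ * G w ≤ H p w := by
  sorry

/-- the `r⁻¹⁴` piece of the label form: `X · (14 (ê·Δw)² − ‖Δw‖²)` summed over bonds. -/
def H14 (t : Fin 2 → E3) (A : E3 →L[ℝ] E3) (w : Label → E3) : ℝ :=
  (∑' a : Label, ∑' b : Label, if a ≠ b then
      (‖sitePos t A a - sitePos t A b‖ ^ 14)⁻¹ *
        (14 * (inner ℝ (sitePos t A a - sitePos t A b) (w a - w b) /
              ‖sitePos t A a - sitePos t A b‖) ^ 2 - ‖w a - w b‖ ^ 2) else 0) / 2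

/-- the `r⁻⁸` piece of the label form: `Y · (‖Δw‖² − 8 (ê·Δw)²)` summed over bonds. -/
def H8 (t : Fin 2 → E3) (A : E3 →L[ℝ] E3) (w : Label → E3) : ℝ :=
  (∑' a : Label, ∑' b : Label, if a ≠ b then
      (‖sitePos t A a - sitePos t A b‖ ^ 8)⁻¹ *
        (‖w a - w b‖ ^ 2 - 8 * (inner ℝ (sitePos t A a - sitePos t A b) (w a - w b) /
              ‖sitePos t A a - sitePos t A b‖) ^ 2) else 0) / 2

/-- **A4 (dilation exactness).** Under the JOINT scaling `(t, A) ↦ (l • t, l • A)` (which moves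
along a chord of the window through the origin of scalings) the full label form is
`l⁻¹⁴ H14 + l⁻⁸ H8`; after division by `l⁻⁸` it is affine in `ψ = l⁻⁶`, and `ψ ↦ ψ H14 + H8 − κ ψ^{-4/3} G`
is operator-concave, so the inequality on a scaling segment follows from its two endpoints:
only the boundary of the window binds in the dilation direction. -/
theorem hlab_scaling (t : Fin 2 → E3) (A : E3 →L[ℝ] E3) (w : Label → E3) (l : ℝ) (hl : 0 < l)
    (hsep : ∀ a b : Label, a ≠ b → sitePos t A a ≠ sitePos t A b) :
    Hlab (fun _ => True) (l • t) (l • A) w = (l ^ 14)⁻¹ * H14 t A w + (l ^ 8)⁻¹ * H8 t A w := by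
  sorry

/-! ## Card B: Gram / sum-of-squares certificates of finite differences (Fourier-free) -/

/-- a stencil element `(m, n, ℓ)`: the finite difference `w (n, p + ℓ) − w (m, p)` at cell `p`. -/
abbrev StencilElem := Fin 2 × Fin 2 × (Fin 3 → ℤ)

/-- the finite-difference operator of a stencil element. -/
def sdiff (b : StencilElem) (w : Label → E3) (p : Fin 3 → ℤ) : E3 :=
  w (b.2.1, p + b.2.2) - w (b.1, p)

/-- Gram (sum-of-squares) form of a block matrix `X` over the stencil `S`:
`∑_p ∑_{b,b' ∈ S} ⟨Δ_b w(p), X_{bb'} Δ_{b'} w(p)⟩`. -/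
def sosForm (S : Finset StencilElem) (X : StencilElem → StencilElem → (E3 →L[ℝ] E3))
    (w : Label → E3) : ℝ :=
  ∑' p : Fin 3 → ℤ, ∑ b ∈ S, ∑ b' ∈ S, inner ℝ (sdiff b w p) (X b b' (sdiff b' w p))

/-- positive semidefiniteness of the Gram block matrix (in Lean: exhibit `X = Lᵀ L` over `ℚ`). -/
def GramPSD (S : Finset StencilElem) (X : StencilElem → StencilElem → (E3 →L[ℝ] E3)) : Prop :=
  ∀ v : StencilElem → E3, 0 ≤ ∑ b ∈ S, ∑ b' ∈ S, inner ℝ (v b) (X b b' (v b'))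

/-- translation-invariant bond form with one quadratic map per stencil element (coefficients
`K b : E3 → ℝ`, e.g. the true `fun v ↦ Hess (bond vector) v` or a rational minorant). -/
def bondForm (S : Finset StencilElem) (K : StencilElem → E3 → ℝ) (w : Label → E3) : ℝ :=
  (∑' p : Fin 3 → ℤ, ∑ b ∈ S, K b (sdiff b w p)) / 2

/-- NN strain form over the NN stencil `S₁` (the typed left-hand side in label space). -/
def GlabS (S₁ : Finset StencilElem) (w : Label → E3) : ℝ :=
  ∑' p : Fin 3 → ℤ, ∑ b ∈ S₁, ‖sdiff b w p‖ ^ 2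

/-- **B1 (soundness of Gram forms).** -/
theorem sosForm_nonneg (S : Finset StencilElem) (X : StencilElem → StencilElem → (E3 →L[ℝ] E3))
    (hX : GramPSD S X) (w : Label → E3) (hw : (Function.support w).Finite) :
    0 ≤ sosForm S X w := by
  sorry

/-- the true LJ bond coefficients at window point `(t, A)`: bond vector of stencil element
`(m, n, ℓ)` is `sitePos (n, ℓ) − sitePos (m, 0)`. -/
def Ktrue (t : Fin 2 → E3) (A : E3 →L[ℝ] E3) (b : StencilElem) (v : E3) : ℝ :=
  Hess (sitePos t A (b.2.1, b.2.2) - sitePos t A (b.1, 0)) v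

/-- **B2 (certificate ⇒ stability at every dominated window point).** An SOS identity for MINORANT
coefficients `Kmin` (rational in practice), `bondForm S Kmin − κ·G = sosForm S X` with `X ⪰ 0`,
certifies `κ·G ≤ bondForm S (Ktrue t A)` at every `(t, A)` whose true bond Hessians dominate the
minorants — no Brillouin zone, no eigenvalues: an identity of quadratic expressions plus `Lᵀ L`. -/
theorem stability_of_certificate (S S₁ : Finset StencilElem) (Kmin : StencilElem → E3 → ℝ)
    (X : StencilElem → StencilElem → (E3 →L[ℝ] E3)) (κ : ℝ) (hX : GramPSD S X)
    (hid : ∀ w : Label → E3, (Function.support w).Finite →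
      bondForm S Kmin w - κ * GlabS S₁ w = sosForm S X w)
    (t : Fin 2 → E3) (A : E3 →L[ℝ] E3)
    (hdom : ∀ b ∈ S, ∀ v : E3, Kmin b v ≤ Ktrue t A b v) :
    ∀ w : Label → E3, (Function.support w).Finite →
      κ * GlabS S₁ w ≤ bondForm S (Ktrue t A) w := by
  sorry

/-- **B3 (bookkeeping, joins B with C).** With `S` = the label bonds of actual length `≤ rc` and
`S₁` = those of length `≤ 11/10` at `(t, A)` (both sets are CONSTANT over the admissible window:
NN lengths lie in `[0.92, 1.02]`, the second shell starts above `1.31`), the stencil forms are the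
label forms of card C. -/
theorem bondForm_eq_Hlab (rc : ℝ) (S S₁ : Finset StencilElem) (t : Fin 2 → E3) (A : E3 →L[ℝ] E3)
    (hS : ∀ b : StencilElem, b ∈ S ↔
      (b.1, (0 : Fin 3 → ℤ)) ≠ ((b.2.1, b.2.2) : Label) ∧
        dist (sitePos t A (b.1, 0)) (sitePos t A (b.2.1, b.2.2)) ≤ rc)
    (hS₁ : ∀ b : StencilElem, b ∈ S₁ ↔
        dist (sitePos t A (b.1, 0)) (sitePos t A (b.2.1, b.2.2)) ≤ 11 / 10)
    (w : Label → E3) (hw : (Function.support w).Finite) :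
    bondForm S (Ktrue t A) w = Hlab (· ≤ rc) t A w ∧ GlabS S₁ w = Glab t A w := by
  sorry

end Summit.AtomisticToContinuum.Crystallization.Cruxes.PhononStability.SketchIdeator2
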